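import Summits.BirchSwinnertonDyer.BirchSwinnertonDyer.Theorems.ByReductionTypeAtTwoAdditivePotGoodPrintKrizLi
import Summits.BirchSwinnertonDyer.BirchSwinnertonDyer.Theorems.GenusKolyvaginAtTwoMinimalTwinBSDTwoKrizLiAnchor37a1Base
import Literature.NumberTheory.EllipticCurves.KrizLi2019.Table1RankOneRows37a1And43a1
import Literature.NumberTheory.EllipticCurves.HeegnerHypothesisKroneckerProofs
import Literature.NumberTheory.QuadraticFields.KroneckerSplitting
import Mathlib.Tactic.NormNum.LegendreSymbol
import HarnessLib

/-!
# Route `GenusKolyvaginAtTwo`, crux U₂ `MinimalTwinBSDTwo` (stmt-BirchSwinnertonDyer-22985), LINE 23 «twin_swap»: THE KRIZ–LI ROAD AT THE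
# RANK-ONE ANCHOR `37a1` OVER `K = ℚ(√−7)` FROM PRINT ALONE — `BSD(·, 2)` on the whole packet `{37a1^{(d)}, 37a1^{(−7d)} : d ∈ 𝒩(37a1, K),
# χ_d(−37) = 1}` from the PRINTED Table-1 row `37a1 | −7 | 1 | ✓` (`KrizLi2019.table1_row37a1`), Kriz–Li Thm 5.1 (2) / Thm 4.3 and
# Creutz–Miller on the conductors `37` and `1813` BY NAME; the rank-ONE members `37a1^{(d)}` are U₂-class curves (non-CM, analytic rank one)
# with `BSD₂` settled by print — NO research stub, NO rank-zero wall; witness `d = 53`: members `37a1^{(53)}` (rank 1, `N = 103933`),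
# `37a1^{(−371)}` (rank 0)

Seat `bsd-line-gk2-p2` g34 (PROVER 2/3, cell `bsd-f1-sign2`; LINE 23 holder), `--supports stmt-BirchSwinnertonDyer-22985` (helper; closes nothing).
THEOREMS ONLY (0 `def`, 0 `sorry`); standard axioms.  HONEST FRAMING (D-0014/D-0036): the U₂-side twin of the K4 seat's `…PrintKrizLi92b1.lean`
(cell `bsd-2adic`; rank-one base `92b1`, additive at `2`): the generic road `AddPotGoodPrint.krizLi_bsdp_two_of_twist_of_conductor_lt` (no rank
input, base-generic) instantiated at `V = 37a1 = Curve37a.E = [0,0,1,−1,0]` — the FIRST rank-one curve, GOOD (supersingular) at `2`, so Kriz–Li's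
Manin-constant clause is void and no Agashe–Ribet–Stein input is needed.  Everything is CONDITIONAL on displayed PRINT named facts:
Kriz–Li 2019 Thm 5.1 (2) (`thm112_bsdTwo_twist`) and Thm 4.3 (`thm33_rank_twist`), the Table-1 row (`table1_row37a1`, §3 onwards; in §2 the
(★)-datum is displayed instead), Creutz–Miller 2012 / Miller 2011 (`bsdTriple_of_analyticRank_le_one_of_conductor_lt`: `BSD(E, 2)` for
`r_an ≤ 1`, `N < 5000` — here at `N = 37` and `N = 1813`), and — for the rank SORTING only — the Modularity theorem (`exists_isNewformOf`,
through the tree's `Curve37a.one_le_analyticRank_E`: `w(37a1) = −1` so `r_an ≥ 1`; with Thm 4.3 `r_an(37a1) = 1`, NO Gross–Zagier–Kolyvagin input).  Kernel: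
`E(ℚ)[2] = 0`, `c₂ = 1`, good at `2`, the Heegner hypothesis for `(37, −7)`, `N = 37`, the partner model `[0,0,1,−49,−86]` with `N = 1813`
(file `…KrizLiAnchor37a1Base.lean`), the packet witness `53 ∈ 𝒩` with `χ₅₃(−37) = 1`.

WHAT THIS SAYS FOR U₂.  U₂ `MinimalTwinBSDTwo` asks `BSD₂` for every non-CM curve of analytic rank one with `#Sel₂ = 2`; LINE 23's skeleton of
record (v2.13.1) reduces it on the odd habitat cut to WALL + PRINT + Q2 + MANIN|₄ + NVFROB + WITNESS_{dc,≥2} (research).  On the KRIZ–LI PACKET of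
a (★)-anchor the research content is DISCHARGED BY PRINT: §3's `printFamily37A1_krizLi_rankOneMembers` gives, at every global minimal
`W₁ ≅ 37a1^{(d)}` (`d ∈ 𝒩(37a1, K)`, `χ_d(−37) = 1`; an infinite family of non-CM rank-one curves of unbounded conductor — Kriz–Li Thm 1.4:
`≫ X/log^{5/6} X` of them), `r_an(W₁) = 1 ∧ ¬CM ∧ BSDp W₁ 2` — U₂'s conclusion on U₂-class curves — and `printFamily37A1_krizLi_rankZeroCompanions`
gives `r_an(W₂) = 0 ∧ ¬CM ∧ BSDp W₂ 2` at the companions `W₂ ≅ 37a1^{(−7d)}` (WALL row-1 instances settled by print).  Compared with g29's packet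
door (`KrizLiPacket.bsdp_packet_of_wallItems_of_assumptionStar_twinTrivial`: WALL + PRINT + a displayed (★)-anchor), here the anchor's `BSD₂`, the
twin's `BSD₂` AND the (★)-certificate are all PRINT (Creutz–Miller at `37`/`1813`, Table 1), so NO wall item and NO displayed certificate remain.
NOT claimed: that every U₂-curve lies in such a packet (Kriz–Li Rem. 1.14); `#Sel₂(W₁) = 2` for the members (not needed for `BSDp`).
PRESEARCH: the transport is [corpus: doi-10-1017-fms-2019-9, Thm. 5.1 (2), p. 30 L43–50]; its numerical inputs at `37a1` are Kriz–Li's own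
Example 6.2/Table 1 and Rem. 5.2 («numerical verification», Miller 2011 `N ≤ 5000`); the composition is corollary-of-print assembled in the kernel —
beyond-print theorem: no.  **BSD is NOT proved by any of this; U₂ is NOT proved; no item is closed.**

CONTENTS. §1 Heegner hypothesis for `(37, −7)`, Kriz–Li's local clause at `2`, the partner presentation. §2 the road with the (★)-datum displayed.
§3 `r_an(37a1) = 1` (root number + Thm 4.3), the road BY NAME from the Table-1 row, the U₂-keyed sorting (rank-one members / rank-zero companions).
§4 the witness `ℓ = 53`.

References: [KrizLi2019] Thm 5.1 (2) (FMS VoR p. 30) = arXiv:1606.03172 Thm 1.12, Thm 4.3, Def 4.1, Rem. 1.14, Rem. 5.2, §6 Ex. 6.2, Table 1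
(row 37a1); [CreutzMiller2012] Thm 1.1; [Miller2011LMS] Def 1.1, Thm 1.2; [CremonaAlgorithms1997] Table 1 (37A1), App. to Ch. II Ex. 3;
[Marcus1977] Ch. 3 Thm. 25; [SilvermanAEC2009] X.5, App. C §11.
-/

set_option autoImplicit false
-- the Theorems namespace of this sub repeats the summit name by design (D-0017 nested layout)
set_option linter.dupNamespace false

noncomputable section

open scoped Classical

open WeierstrassCurve NumberField Literature.NumberTheory.EllipticCurves
  Literature.NumberTheory.EllipticCurves.ModularForms
  Literature.NumberTheory.EllipticCurves.Rank1Residual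
  Literature.NumberTheory.EllipticCurves.Rank1Residual.Typed
  Literature.NumberTheory.EllipticCurves.Curve37a
  Summit.BirchSwinnertonDyer.Rank1Residual
  Summit.BirchSwinnertonDyer.Rank1Residual.P2
  Summit.BirchSwinnertonDyer.BirchSwinnertonDyer.Theorems.AddPotGoodPrint

namespace Summit.BirchSwinnertonDyer.BirchSwinnertonDyer.Theorems.GenusExact.TwinSwap.KrizLiAnchor37a1

/-! ## §1 The Heegner field `K`, `d_K = −7`: `37` splits; Kriz–Li's standing hypotheses at `37a1` -/
section Base37A1Field

/-- **The Heegner hypothesis for `(37a1, K)`, `d_K = −7`**: the prime `37` of `N = 37` splits in `K` (`(−7/37) = 1`).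
[cite: KrizLi2019, Thm. 5.1 hypothesis "K satisfies the Heegner hypothesis for N"] [cite: Marcus1977, Ch. 3 Thm. 25] -/
theorem satisfiesHeegnerHypothesis_37A1 {K : Type} [Field K] [NumberField K] (h2 : Module.finrank ℚ K = 2)
    (hdK : NumberField.discr K = -7) :
    SatisfiesHeegnerHypothesis (E.conductorNorm ℤ) K := by
  rw [conductorNorm_E, satisfiesHeegnerHypothesis_iff_kronecker _ K h2, hdK]
  intro q hq hqN
  obtain rfl := (Nat.prime_dvd_prime_iff_eq hq (by norm_num)).mp hqN
  exact ⟨fun h => absurd h (by norm_num), fun _ => by norm_num⟩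

/-- **Kriz–Li's local hypotheses at `2` for `E = 37a1`**: `c₂(E) = 1` odd (kernel: good reduction at `2`) and the Manin-constant clause VOID (`E` is
good at `2`, not additive) — for ANY parametrisation datum. [cite: KrizLi2019, Thm. 5.1 hypotheses "c₂(E) odd; Manin constant odd if additive at 2"] -/
theorem krizLi_loc_37A1 [NeZero (E.conductorNorm ℤ)] (Dt : ModularParametrizationData E (E.conductorNorm ℤ)) :
    haveI : Fact (2 : ℕ).Prime := ⟨Nat.prime_two⟩
    Odd ((E.baseChange ℚ_[2]).localTamagawaNumber ℤ_[2]) ∧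
      (¬ E.HasGoodReductionAtPrime 2 → ¬ E.HasMultiplicativeReductionAtPrime 2 → Odd Dt.c) :=
  ⟨odd_localTamagawaNumber_two_37A1, fun h _ => absurd hasGoodReductionAtPrime_two_37A1 h⟩

/-- The partner model `[0,0,1,−49,−86]` IS a model of `37a1^{(d_K)}` for `d_K = −7` (change of variables `(1, 0, 0, ½)`).
[cite: SilvermanAEC2009, X.5 Cor. 5.4] -/
theorem partner_37A1 {K : Type} [Field K] [NumberField K] (hdK : NumberField.discr K = -7) :
    ∃ C : VariableChange ℚ, C • E.quadraticTwist (NumberField.discr K : ℚ) = (⟨0, 0, 1, -49, -86⟩ : WeierstrassCurve ℚ) :=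
  ⟨⟨1, 0, 0, (1 : ℚ) / 2⟩, by rw [hdK]; push_cast; exact smul_quadraticTwist_neg7_37A1⟩

/-- **Non-CM along the packet**: every `ℚ`-model of a quadratic twist of `37a1` is non-CM (`j(W) = j(37a1) = 2¹²·3³/37`, not an integer).
[cite: SilvermanAEC2009, App. C §11 and X.5] -/
theorem not_hasCM_of_smul_quadraticTwist_37A1 {d : ℚ} (hd : d ≠ 0) (W : WeierstrassCurve ℚ) [W.IsElliptic]
    (hW : ∃ C : VariableChange ℚ, C • E.quadraticTwist d = W) : ¬ W.HasCM := by
  obtain ⟨C, rfl⟩ := hW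
  haveI := E.isElliptic_quadraticTwist hd
  have hj : (C • E.quadraticTwist d).j = E.j := by rw [variableChange_j, j_quadraticTwist E hd]
  rw [hasCM_iff_of_j_eq hj]
  exact not_hasCM_37A1

end Base37A1Field

/-! ## §2 THE ROAD AT `37a1` with the (★)-datum DISPLAYED (any `K` with `d_K = −7`) -/
section Road37A1

/-- **`BSD(W′, 2)` at EVERY global minimal `W′ ≅ 37a1^{(d)}` or `≅ 37a1^{(−7d)}`, `d ∈ 𝒩(37a1, K)`, `χ_d(−37) = 1`** — the (★)-datum (`Dt`, `H`,
`ι`, `P ↦` Heegner point, `j`, (★)) displayed; everything else kernel or by name (Kriz–Li Thm 5.1 (2) + 4.3, Creutz–Miller on `37` and `1813`).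
NO rank input, NO wall, NO Manin input.  BSD is not proved by any of this.
[cite: KrizLi2019, Thm. 5.1 (2) and Thm. 4.3] [cite: CreutzMiller2012, Thm. 1.1] [cite: Miller2011LMS, Def. 1.1] -/
theorem krizLi_bsdp_two_of_twist_37A1 (hKL : KrizLi2019.thm112_bsdTwo_twist) (h33 : KrizLi2019.thm33_rank_twist)
    (hS31 : bsdTriple_of_analyticRank_le_one_of_conductor_lt)
    (K : Type) [Field K] [NumberField K] (hK : IsImaginaryQuadratic K) (hdK : NumberField.discr K = -7)
    [NeZero (E.conductorNorm ℤ)]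
    (Dt : ModularParametrizationData E (E.conductorNorm ℤ))
    (H : HeegnerDatum (E.conductorNorm ℤ) (NumberField.discr K))
    (ι : K →+* ℂ) (P : (E.baseChange K).toAffine.Point) (hP : WeierstrassCurve.Affine.Point.map ι.toRatAlgHom P = heegnerPointComplex Dt H)
    (j : K →ₐ[ℚ] ℚ_[2]) (hstar : haveI := isGloballyMinimal_37A1; KrizLi2019.AssumptionStar E Dt K P j)
    {d : ℤ} (hd : haveI := isGloballyMinimal_37A1; KrizLi2019.InN E K d)
    (hsign : Int.sign d * jacobiSym (E.conductorNorm ℤ) d.natAbs = 1)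
    (W' : WeierstrassCurve ℚ) [W'.IsElliptic] [W'.IsGloballyMinimal]
    (hW' : (∃ C : VariableChange ℚ, C • E.quadraticTwist (d : ℚ) = W') ∨
      (∃ C : VariableChange ℚ, C • E.quadraticTwist ((d * NumberField.discr K : ℤ) : ℚ) = W')) :
    BSDp W' 2 := by
  haveI := isGloballyMinimal_37A1
  haveI := isElliptic_T37A1; haveI := isGloballyMinimal_T37A1
  exact krizLi_bsdp_two_of_twist_of_conductor_lt _ hKL h33 hS31 conductorNorm_lt_5000_37A1 twoTorsion_37A1 K hK
    (satisfiesHeegnerHypothesis_37A1 hK.1 hdK) Dt H ι P hP j hstar (krizLi_loc_37A1 Dt) (⟨0, 0, 1, -49, -86⟩ : WeierstrassCurve ℚ)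
    (partner_37A1 hdK) conductorNorm_lt_5000_T37A1 hd hsign W' hW'

end Road37A1

/-! ## §3 `r_an(37a1) = 1` (root number `−1` + Thm 4.3); the road BY NAME from the Table-1 row; the U₂-keyed sorting -/
section Road37A1ByName

/-- **`ord_{s=1} L(37a1, s) = 1`** granted Thm 4.3 (`h33`: `≤ 1` at `d = 1` over `ℚ(√−7)`), the Table-1 row (`htab`: the (★)-datum) and the
Modularity theorem (`hmod`: `w(37a1) = −1` by the tree's `Curve37a.rootNumber_E`, so `r_an` is odd, `Curve37a.one_le_analyticRank_E`) — no
Gross–Zagier–Kolyvagin input, no kernel numerics on `L′`. [cite: KrizLi2019, Thm. 4.3 and §6 Table 1 (row 37a1, "rank one curves")]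
[cite: CremonaAlgorithms1997, Table 1 (37A1: r = 1)] [cite: SilvermanAEC2009, C.16 Thm. 16.3 and remark] -/
theorem analyticRank_37A1 (h33 : KrizLi2019.thm33_rank_twist) (htab : KrizLi2019.table1_row37a1) (hmod : exists_isNewformOf) :
    E.analyticRank = 1 := by
  haveI := isGloballyMinimal_37A1
  haveI : Fact ((-7 : ℤ) < 0) := ⟨by norm_num⟩
  obtain ⟨hIQ, hdisc⟩ := P2.isImaginaryQuadratic_and_discr_of_sq_eq_neg_prime (sqrtField.finrank_eq_two (-7))
    (p := 7) (by norm_num) (by norm_num) (x := sqrtField.r (-7)) (by rw [sqrtField.r_sq']; push_cast; ring)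
  obtain ⟨_, Dt, H, ι, P, j, -, hP, hstar⟩ := htab (sqrtField (-7)) hIQ hdisc
  have hle := krizLi_analyticRank_le_one _ h33 twoTorsion_37A1 (sqrtField (-7)) hIQ (satisfiesHeegnerHypothesis_37A1 hIQ.1 hdisc)
    Dt H ι P hP j hstar
  have hge := one_le_analyticRank_E hmod
  omega

/-- **`BSD(W′, 2)` at EVERY global minimal `W′ ≅ 37a1^{(d)}` or `≅ 37a1^{(−7d)}`**, `d ∈ 𝒩(37a1, K)`, `χ_d(−37) = 1`, BY NAME from the Table-1 row
(no displayed input beyond print). [cite: KrizLi2019, Thm. 5.1 (2), Thm. 4.3, §6 Table 1 (row 37a1)] [cite: CreutzMiller2012, Thm. 1.1] [cite: Miller2011LMS, Def. 1.1] -/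
theorem krizLi_bsdp_two_of_twist_37A1_of_table1 (hKL : KrizLi2019.thm112_bsdTwo_twist) (h33 : KrizLi2019.thm33_rank_twist)
    (htab : KrizLi2019.table1_row37a1) (hS31 : bsdTriple_of_analyticRank_le_one_of_conductor_lt)
    (K : Type) [Field K] [NumberField K] (hK : IsImaginaryQuadratic K) (hdK : NumberField.discr K = -7)
    {d : ℤ} (hd : haveI := isGloballyMinimal_37A1; KrizLi2019.InN E K d)
    (hsign : Int.sign d * jacobiSym (E.conductorNorm ℤ) d.natAbs = 1)
    (W' : WeierstrassCurve ℚ) [W'.IsElliptic] [W'.IsGloballyMinimal]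
    (hW' : (∃ C : VariableChange ℚ, C • E.quadraticTwist (d : ℚ) = W') ∨
      (∃ C : VariableChange ℚ, C • E.quadraticTwist ((-7 * d : ℤ) : ℚ) = W')) :
    BSDp W' 2 := by
  haveI := isGloballyMinimal_37A1
  obtain ⟨_, Dt, H, ι, P, j, -, hP, hstar⟩ := htab K hK hdK
  have hdK' : ((d * NumberField.discr K : ℤ) : ℚ) = ((-7 * d : ℤ) : ℚ) := by rw [hdK]; push_cast; ring
  exact krizLi_bsdp_two_of_twist_37A1 hKL h33 hS31 K hK hdK Dt H ι P hP j hstar hd hsign W' (by rw [hdK']; exact hW')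

/-- **THE RANK-ONE MEMBERS `37a1^{(d)}` — U₂-CLASS CURVES SETTLED BY PRINT**: at every global minimal `W₁ ≅ 37a1^{(d)}` (`d ∈ 𝒩(37a1, K)`,
`χ_d(−37) = 1`): `r_an(W₁) = 1 ∧ ¬CM ∧ BSD(W₁, 2)`.  By name: Thm 5.1 (2), Thm 4.3, the Table-1 row, Creutz–Miller, modularity (for `r_an(37a1) = 1`).
An infinite print-decided family of non-CM analytic-rank-one curves inside U₂'s quantifier range.  BSD is not proved by any of this; U₂ is not proved.
[cite: KrizLi2019, Thm. 5.1 (2), Thm. 4.3, Thm. 1.4, §6 Table 1 (row 37a1)] [cite: CreutzMiller2012, Thm. 1.1] [cite: Miller2011LMS, Def. 1.1] -/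
theorem printFamily37A1_krizLi_rankOneMembers (hKL : KrizLi2019.thm112_bsdTwo_twist) (h33 : KrizLi2019.thm33_rank_twist)
    (htab : KrizLi2019.table1_row37a1) (hS31 : bsdTriple_of_analyticRank_le_one_of_conductor_lt) (hmod : exists_isNewformOf)
    (K : Type) [Field K] [NumberField K] (hK : IsImaginaryQuadratic K) (hdK : NumberField.discr K = -7)
    {d : ℤ} (hd : haveI := isGloballyMinimal_37A1; KrizLi2019.InN E K d)
    (hsign : Int.sign d * jacobiSym (E.conductorNorm ℤ) d.natAbs = 1)
    (W₁ : WeierstrassCurve ℚ) [W₁.IsElliptic] [W₁.IsGloballyMinimal]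
    (hW₁ : ∃ C : VariableChange ℚ, C • E.quadraticTwist (d : ℚ) = W₁) :
    W₁.analyticRank = 1 ∧ ¬ W₁.HasCM ∧ BSDp W₁ 2 := by
  haveI := isGloballyMinimal_37A1
  have hr1 := analyticRank_37A1 h33 htab hmod
  obtain ⟨_, Dt, H, ι, P, j, -, hP, hstar⟩ := htab K hK hdK
  have hB : BSDp W₁ 2 := krizLi_bsdp_two_of_twist_37A1 hKL h33 hS31 K hK hdK Dt H ι P hP j hstar hd hsign W₁ (Or.inl hW₁)
  have hD : (NumberField.discr K : ℚ) ≠ 0 := by exact_mod_cast NumberField.discr_ne_zero K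
  have hd0 : (d : ℚ) ≠ 0 := cast_ne_zero_of_inN _ hd
  have hdK0 : ((d * NumberField.discr K : ℤ) : ℚ) ≠ 0 := by push_cast; exact mul_ne_zero hd0 hD
  obtain ⟨W₂, _, _, hW₂⟩ := exists_globallyMinimal_twist E hdK0
  obtain ⟨-, heq⟩ := krizLi_analyticRank_twists _ h33 twoTorsion_37A1 K hK (satisfiesHeegnerHypothesis_37A1 hK.1 hdK) Dt H ι P hP j hstar
    hd hsign W₁ W₂ hW₁ hW₂
  exact ⟨by rw [heq, hr1], not_hasCM_of_smul_quadraticTwist_37A1 hd0 W₁ hW₁, hB⟩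

/-- **THE RANK-ZERO COMPANIONS `37a1^{(−7d)}` — WALL ROW-1 INSTANCES SETTLED BY PRINT**: at every global minimal `W₂ ≅ 37a1^{(−7d)}`
(`d ∈ 𝒩(37a1, K)`, `χ_d(−37) = 1`): `r_an(W₂) = 0 ∧ ¬CM ∧ BSD(W₂, 2)`.  BSD is not proved by any of this.
[cite: KrizLi2019, Thm. 5.1 (2), Thm. 4.3, §6 Table 1 (row 37a1)] [cite: CreutzMiller2012, Thm. 1.1] [cite: Miller2011LMS, Def. 1.1] -/
theorem printFamily37A1_krizLi_rankZeroCompanions (hKL : KrizLi2019.thm112_bsdTwo_twist) (h33 : KrizLi2019.thm33_rank_twist)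
    (htab : KrizLi2019.table1_row37a1) (hS31 : bsdTriple_of_analyticRank_le_one_of_conductor_lt) (hmod : exists_isNewformOf)
    (K : Type) [Field K] [NumberField K] (hK : IsImaginaryQuadratic K) (hdK : NumberField.discr K = -7)
    {d : ℤ} (hd : haveI := isGloballyMinimal_37A1; KrizLi2019.InN E K d)
    (hsign : Int.sign d * jacobiSym (E.conductorNorm ℤ) d.natAbs = 1)
    (W₂ : WeierstrassCurve ℚ) [W₂.IsElliptic] [W₂.IsGloballyMinimal]
    (hW₂ : ∃ C : VariableChange ℚ, C • E.quadraticTwist ((-7 * d : ℤ) : ℚ) = W₂) :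
    W₂.analyticRank = 0 ∧ ¬ W₂.HasCM ∧ BSDp W₂ 2 := by
  haveI := isGloballyMinimal_37A1
  have hr1 := analyticRank_37A1 h33 htab hmod
  obtain ⟨_, Dt, H, ι, P, j, -, hP, hstar⟩ := htab K hK hdK
  have hdK' : ((d * NumberField.discr K : ℤ) : ℚ) = ((-7 * d : ℤ) : ℚ) := by rw [hdK]; push_cast; ring
  have hW₂' : ∃ C : VariableChange ℚ, C • E.quadraticTwist ((d * NumberField.discr K : ℤ) : ℚ) = W₂ := by rw [hdK']; exact hW₂
  have hB : BSDp W₂ 2 := krizLi_bsdp_two_of_twist_37A1 hKL h33 hS31 K hK hdK Dt H ι P hP j hstar hd hsign W₂ (Or.inr hW₂')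
  have hd0 : (d : ℚ) ≠ 0 := cast_ne_zero_of_inN _ hd
  obtain ⟨W₁, _, _, hW₁⟩ := exists_globallyMinimal_twist E hd0
  obtain ⟨hor, heq⟩ := krizLi_analyticRank_twists _ h33 twoTorsion_37A1 K hK (satisfiesHeegnerHypothesis_37A1 hK.1 hdK) Dt H ι P hP j hstar
    hd hsign W₁ W₂ hW₁ hW₂'
  have hr2 : W₂.analyticRank = 0 := by omega
  have hdd0 : ((-7 * d : ℤ) : ℚ) ≠ 0 := by push_cast; exact mul_ne_zero (by norm_num) hd0
  exact ⟨hr2, not_hasCM_of_smul_quadraticTwist_37A1 hdd0 W₂ hW₂, hB⟩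

end Road37A1ByName

/-! ## §4 The witness `ℓ = 53`: `a₅₃ = 1` odd, `53` splits in `ℚ(√−7)`, `χ₅₃(−37) = 1`; members `37a1^{(53)}` (rank 1), `37a1^{(−371)}` (rank 0) -/
section Witness37A1

/-- **`ℓ ∈ 𝒮(37a1, K)`** from: `ℓ` prime, `ℓ ∉ {2, 37}`, `(−7/ℓ) = 1`, `a_ℓ(37a1)` odd. [cite: KrizLi2019, Def. 4.1] [cite: Marcus1977, Ch. 3 Thm. 25] -/
theorem inS_37A1 {K : Type} [Field K] [NumberField K] (h2 : Module.finrank ℚ K = 2) (hdK : NumberField.discr K = -7)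
    {ℓ : ℕ} (hℓ : ℓ.Prime) (hℓ2 : ℓ ≠ 2) (hℓ37 : ℓ ≠ 37) (hj : jacobiSym (-7) ℓ = 1)
    (hodd : haveI := isGloballyMinimal_37A1; Odd (E.frobeniusTrace ℓ)) :
    haveI := isGloballyMinimal_37A1
    KrizLi2019.InS E K ℓ := by
  haveI := isGloballyMinimal_37A1
  refine ⟨hℓ, ?_, ?_, hodd⟩
  · rw [conductorNorm_E]
    intro h
    rcases (Nat.Prime.dvd_mul hℓ).mp h with h | h
    · exact hℓ2 ((Nat.prime_dvd_prime_iff_eq hℓ Nat.prime_two).mp h)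
    · exact hℓ37 ((Nat.prime_dvd_prime_iff_eq hℓ (by norm_num)).mp h)
  · rw [Literature.NumberTheory.QuadraticFields.Quadratic.ncard_primesOver_eq_two_iff_jacobiSym h2 hℓ hℓ2, hdK]
    exact hj

/-- **`53 ∈ 𝒩(37a1, K)`** (`d_K = −7`): `53 ≡ 1 (mod 4)`, `53 ∉ {2, 37}`, `(−7/53) = 1`, `a₅₃ = 1` odd. [cite: KrizLi2019, Def. 4.1] -/
theorem inN_53_37A1 {K : Type} [Field K] [NumberField K] (h2 : Module.finrank ℚ K = 2) (hdK : NumberField.discr K = -7) :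
    haveI := isGloballyMinimal_37A1
    KrizLi2019.InN E K 53 := by
  haveI := isGloballyMinimal_37A1
  have h53 : Nat.Prime 53 := by norm_num
  have hna : (53 : ℤ).natAbs = 53 := rfl
  refine ⟨by decide, by rw [hna]; exact h53.squarefree, fun ℓ hℓ hℓd => ?_⟩
  rw [hna] at hℓd
  obtain rfl := (Nat.prime_dvd_prime_iff_eq hℓ h53).mp hℓd
  exact inS_37A1 h2 hdK h53 (by norm_num) (by norm_num) (by norm_num) odd_frobeniusTrace_53_37A1

/-- **`χ₅₃(−37) = 1`**: `sgn(53)·(37/53) = (53/37) = (16/37) = 1`, read with `N = 37` exact. [cite: KrizLi2019, Thm. 5.1 (2) condition "χ_d(−N) = 1"] -/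
theorem sign_53_37A1 : Int.sign 53 * jacobiSym (E.conductorNorm ℤ) (53 : ℤ).natAbs = 1 := by
  rw [conductorNorm_E, show (53 : ℤ).natAbs = 53 from rfl]; norm_num

/-- **The rank-one member `37a1^{(53)}`** (`N = 37·53² = 103933`): `r_an = 1 ∧ ¬CM ∧ BSD(·, 2)` at every global minimal model, BY NAME — the `37a1`
road is not vacuous on the U₂ side. BSD is not proved by any of this. [cite: KrizLi2019, Thm. 5.1 (2), Thm. 4.3, §6 Table 1 (row 37a1)] [cite: CreutzMiller2012, Thm. 1.1] -/
theorem printFamily37A1_krizLi_witness53 (hKL : KrizLi2019.thm112_bsdTwo_twist) (h33 : KrizLi2019.thm33_rank_twist)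
    (htab : KrizLi2019.table1_row37a1) (hS31 : bsdTriple_of_analyticRank_le_one_of_conductor_lt) (hmod : exists_isNewformOf)
    (K : Type) [Field K] [NumberField K] (hK : IsImaginaryQuadratic K) (hdK : NumberField.discr K = -7)
    (W₁ : WeierstrassCurve ℚ) [W₁.IsElliptic] [W₁.IsGloballyMinimal]
    (hW₁ : ∃ C : VariableChange ℚ, C • E.quadraticTwist ((53 : ℤ) : ℚ) = W₁) :
    W₁.analyticRank = 1 ∧ ¬ W₁.HasCM ∧ BSDp W₁ 2 :=
  printFamily37A1_krizLi_rankOneMembers hKL h33 htab hS31 hmod K hK hdK (inN_53_37A1 hK.1 hdK) sign_53_37A1 W₁ hW₁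

/-- **The rank-zero companion `37a1^{(−371)}`** (`−371 = (−7)·53`): `r_an = 0 ∧ ¬CM ∧ BSD(·, 2)` at every global minimal model, BY NAME.
BSD is not proved by any of this. [cite: KrizLi2019, Thm. 5.1 (2), Thm. 4.3, §6 Table 1 (row 37a1)] [cite: CreutzMiller2012, Thm. 1.1] -/
theorem printFamily37A1_krizLi_witness_neg371 (hKL : KrizLi2019.thm112_bsdTwo_twist) (h33 : KrizLi2019.thm33_rank_twist)
    (htab : KrizLi2019.table1_row37a1) (hS31 : bsdTriple_of_analyticRank_le_one_of_conductor_lt) (hmod : exists_isNewformOf)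
    (K : Type) [Field K] [NumberField K] (hK : IsImaginaryQuadratic K) (hdK : NumberField.discr K = -7)
    (W₂ : WeierstrassCurve ℚ) [W₂.IsElliptic] [W₂.IsGloballyMinimal]
    (hW₂ : ∃ C : VariableChange ℚ, C • E.quadraticTwist ((-371 : ℤ) : ℚ) = W₂) :
    W₂.analyticRank = 0 ∧ ¬ W₂.HasCM ∧ BSDp W₂ 2 :=
  printFamily37A1_krizLi_rankZeroCompanions hKL h33 htab hS31 hmod K hK hdK (inN_53_37A1 hK.1 hdK) sign_53_37A1 W₂
    (by rw [show ((-7 * 53 : ℤ) : ℚ) = ((-371 : ℤ) : ℚ) by norm_num]; exact hW₂)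

end Witness37A1

end Summit.BirchSwinnertonDyer.BirchSwinnertonDyer.Theorems.GenusExact.TwinSwap.KrizLiAnchor37a1

end
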